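import Summits.BirchSwinnertonDyer.BirchSwinnertonDyer.Theses.PrintX10b
import Summits.BirchSwinnertonDyer.BirchSwinnertonDyer.Theorems.PrintX10bHowardRoad
import Summits.BirchSwinnertonDyer.Rank1Residual.X1.MuLambdaAlgebra
import Literature.NumberTheory.EllipticCurves.YanZhu2026.BDPMainConjectureAtTrivialCharacterOfHeegnerDivisibility
import HarnessLib

/-!
# Line `greenberg-mu-isolation-x10b` on crux stmt-BirchSwinnertonDyer-23730 `TwoSidedLinkAnyClassNumberX10b`
(route PrintX10b, r304 = B₃; registry crux decl
`Summit.BirchSwinnertonDyer.BirchSwinnertonDyer.Theses.PrintX10b.TwoSidedLinkAnyClassNumberX10b`).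
Seat bsd-idea-16 g1 (D-0145 ideator, lens «decomp»). BSD is not proved by any of this.

DECOMPOSITION ALONG THE HEIGHT-ONE PRIME `(3)` OF `Λ^{ur} = ℤ_3^{ur}⟦T⟧` — the BDP-side twin of the sister
line `mu-isolation-x10b` on crux 23729. Write `𝓕` for a generator of `Char_Λ(𝒳_{𝓕_Gr})` (the module
`AcSelmer.XAc (E_K) p κ v̄ ∅ γ`) and `L = 𝓛_p^BDP(E/K) ∈ Λ^{ur}`. The four-line algebra behind the typed
composites (Yan–Zhu Thm. 5.7 (1), RATIONAL sentence: `p^a 𝓕 = w p^b L`, `w ∈ (Λ^{ur})^×`, because the units of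
`Λ^{ur}[1/p]` are `(Λ^{ur})^× · p^ℤ`; BCS Prop. 4.2.2 = Hsieh Thm. B: `μ(L) = 0`, whence `a ≤ b`) gives, with NO
Howard input and NO class-number hypothesis in print,
    `𝓕 = w · p^{μ(𝒳_Gr)} · L`,   hence   `ord_p 𝓕(0) = μ(𝒳_Gr) + ord_p L(𝟙)`,
and CGLS Thm. 5.1.3 evaluates `ord_p L(𝟙) = 2·(ord_p(1 − a_p + p) − 1 + ord_p log_ω P_K) − 2·ord_p c_E`. So the
TWO-SIDED link B₃ (`ord_p 𝓕(0) =` that number) is EQUIVALENT, modulo this class-free print, to the single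
statement `μ(𝒳_{𝓕_Gr}(E/K_∞⁻)) = 0`; and Howard's containment enters print (Yan–Zhu Thm. 5.9 with `S ⊂ Λ^×`,
BCK21 Thm. 5.2) ONLY to give `L ∈ (𝓕)Λ^{ur}`, i.e. `μ(𝓕) ≤ μ(L) = 0`. At `3 ∣ h_K` every known defect of the
transfer is a POWER OF `p` (Yan–Zhu Def. 3.10 `𝓛_p^Gr = h_K·𝓛_𝔭(K)′·𝓛_p^II`; the index of Howard's module `ℋ_F`
in the Λ-adic class through `K[p^{d(k)}]`, CGLS §4.1; the projection `Gal(K[p^∞]/K) → Γ` past its `p`-torsion),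
i.e. a pure `μ`-ambiguity — exactly what stub 2 isolates.

B₃ ⇐ stub 1 ∧ stub 2 ∧ (route item `JSWAnticyclotomicControl`, by name):
* `stub_muSharpOneSided` (PRINT modulo typing, class-number-free, Howard-free): the one-sided composite
  `YanZhu2026.thm57_bcs422_cgls513_generator_constantCoeff` (`𝓕(0) = u·p^k·(…)²`, `k ≥ 0`; route item
  `YZAnticyclotomicGeneratorConstantCoeffThree`) with its exponent IDENTIFIED: `k = μ(𝓕)`.
* `stub_muZeroOfHowardContainment` (THE content, beyond print at `3 ∣ h_K`): on an X10b Heegner frame with ANY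
  class number, Howard's containment `char(𝔖/ℋ_F)² ⊆ char(𝔛_{ord,tors})` ⟹ `μ(𝒳_{𝓕_Gr}) = 0`.
* `TwoSidedLinkAnyClassNumberX10b_of` (stub 1 → stub 2 → JSW → B₃): PROVED — JSW 3.3.1 gives the generator with
  `𝓕(0) ≠ 0`, stub 1 at the conjugate embedding, stub 2, the σ-bridge (`exists_involutive_comp_eq`,
  `padicLogOrd_comp_eq_of_rank_one`), `p ∤ c(Dt)`, `omega`.
Kernel evidence: `muZero_coprime_of_composite_of_muSharp` — at `3 ∤ h_K` stub 2 (on frames carrying a Heegner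
datum, as every frame of the crux does) follows from the typed composite `…_of_heegnerDivisibility` and stub 1
by `HasCharValuationAt.unique`. So the line's beyond-print content is stub 2 at `3 ∣ h_K`, a statement about
ONE Iwasawa invariant of ONE module.

CREDIT / POSITION. The identity "exponent of the one-sided link `= μ(𝒳_Gr)`" was filed independently on this
crux by seat bsd-idea-5 g2 (`Ideas/mu-only-transfer-x10b.md`, 2026-08-28T05:59Z, lens «transfer») with a
different cut: T1 = a μ-LOCALISED class-free transfer (`containment ⟹ ∃ s, μ(s) = 0 ∧ s·L ∈ (𝓕)R₀⟦T⟧`) + T2 =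
the closing algebra. This line cuts at the END INVARIANT instead: its open stub (`μ(𝒳_Gr) = 0` given Howard)
has no `L`-function, no `R₀⟦T⟧`, no transfer vocabulary, is implied by T1 ∧ T2 ∧ print and by the lead's
pinned class-free transfer hypothesis `h59gp` ∧ BCS 4.2.2 (p607932 / p608225), and can be closed by any
`μ`-argument; the print side is ONE class-free statement in the currency of the route's own one-sided item,
glued by `omega`. If the lead's page check accepts Yan–Zhu 5.9 as class-free print, B₃ is closed by the
landed turnkeys and both μ-lines are moot; this line is the fallback typing for the other branch.
-/

set_option linter.dupNamespace false
set_option autoImplicit false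

noncomputable section

open scoped Classical

open WeierstrassCurve NumberField IsDedekindDomain Field Literature.NumberTheory.EllipticCurves
  Literature.NumberTheory.EllipticCurves.ModularForms Literature.NumberTheory.EllipticCurves.YanZhu2026
  Literature.NumberTheory.EllipticCurves.JetchevSkinnerWan2017 Literature.NumberTheory.EllipticCurves.Castella2018

open Summit.BirchSwinnertonDyer.Rank1Residual
open Summit.BirchSwinnertonDyer.Rank1Residual.X1.MuLambda (mu)
open Literature.NumberTheory.EllipticCurves.Rank1Residual (ClassX10 Surj GoodOrd)

namespace Summit.BirchSwinnertonDyer.BirchSwinnertonDyer.Cruxes.TwoSidedLinkAnyClassNumberX10b.GreenbergMuIsolationX10b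

/-! ## Stub statements as named propositions -/

/-- **Stub 1 — the one-sided BDP link with its exponent identified as the `μ`-invariant** (class-number-free,
Howard-free; binders = those of `YanZhu2026.thm57_bcs422_cgls513_generator_constantCoeff` plus ONE generator
`G` of `Char_Λ(𝒳_{𝓕_Gr})` with `G(0) ≠ 0`): `ord_p G(0) = μ(G) + 2·(ord_p(1 − a_p + p) − 1 + ord_p log_ω P_K) −
2·ord_p c(Dt)`. PRINT modulo typing: Yan–Zhu Thm. 5.7 (1) (rational sentence; at `p = 3` proof-level flag
`YZ26@3-BF-ERL-Ohta`) + BCS Prop. 4.2.2 (Hsieh Thm. B: `p` unramified, `ρ̄|_{G_K}` absolutely irreducible — no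
class number) + CGLS Thm. 5.1.3, by `𝓕 = w·p^{μ(𝓕)}·L` in `Λ^{ur}`. The typed tree facts record only `∃ k ≥ 0`
(one-sided composite) or `k = 0` under Howard AND `p ∤ h_K` (two-sided composite); the single-source typed
Thm. 5.7 (1) carries the vocabulary field `Thm57Hypotheses.not_dvd_classNumber`, print does not (Yan–Zhu §5.2).
[cite: YanZhu2024MainConjNonCM, Thm. 5.7 (1) (arXiv:2412.20078v4 l.1217–1223), §5.2]
[cite: BurungaleCastellaSkinner2025, Prop. 4.2.2 (p. 9)] [cite: Hsieh2014, Thm. B]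
[cite: CastellaGrossiLeeSkinner2022, Thm. 5.1.3] -/
def Stmt.stub_muSharpOneSided : Prop :=
  ∀ (W : WeierstrassCurve ℚ) [W.IsElliptic] [W.IsGloballyMinimal] (p : ℕ) [Fact p.Prime],
    3 ≤ p → GoodOrd W p →
    ∀ (K : Type) [Field K] [NumberField K], IsImaginaryQuadratic K →
      SatisfiesHeegnerHypothesis (W.conductorNorm ℤ) K → SatisfiesHeegnerHypothesis p K →
      Odd (NumberField.discr K) → NumberField.discr K ≠ -3 →
      (W.baseChange K).HasIrreducibleModPGaloisRep p →
    ∀ (ι : K →+* ℚ_[p]) (v vbar : HeightOneSpectrum (𝓞 K)),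
      (∀ x : 𝓞 K, x ∈ v.asIdeal ↔ ‖ι (x : K)‖ < 1) →
      ((p : ℕ) : 𝓞 K) ∈ vbar.asIdeal → vbar ≠ v →
    ∀ (κ : ZpExtension K p), κ.IsAnticyclotomic →
    ∀ (γ : absoluteGaloisGroup K) [Fact (κ.IsTopGenerator γ)],
    ∀ (N : ℕ) [NeZero N] (Dt : ModularParametrizationData W N)
      (H : HeegnerDatum N (NumberField.discr K)) (ιC : K →+* ℂ) (P : (W.baseChange K).toAffine.Point),
      WeierstrassCurve.Affine.Point.map ιC.toRatAlgHom P = heegnerPointComplex Dt H →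
    ∀ (G : IwasawaAlgebra p),
      AcSelmer.XAc.charIdeal (W.baseChange K) p κ vbar ∅ γ = Ideal.span {G} →
      PowerSeries.constantCoeff G ≠ 0 →
      ∃ n : ℕ, AcSelmer.XAc.HasCharValuationAt (W.baseChange K) p κ vbar ∅ γ n ∧
        (n : ℤ) = (mu G : ℤ) + 2 * ((padicValInt p (1 - W.frobeniusTrace p + p) : ℤ) - 1 +
          Literature.NumberTheory.EllipticCurves.padicLogOrd W p ι P) - 2 * (padicValInt p Dt.c : ℤ)

/-- **Stub 2 — `μ(𝒳_{𝓕_Gr}) = 0` from Howard's containment, at ANY class number** (THE content; crux letter: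
an X10b non-CM Heegner frame, `d_K` odd `≠ −3`, (irr_K), `κ` anticyclotomic, any prime `v̄ ∣ p` as the strict
prime, Howard's containment for SOME `(jbar, 𝔖, ℋ_F, 𝔛)` exactly as the crux states it, and the generator `G`
with `G(0) ≠ 0` that JSW 3.3.1 provides in rank one): `μ(G) = 0`. At `3 ∤ h_K`: print — Yan–Zhu Thm. 5.9 with
`S ⊂ Λ^×` (BCK21 Thm. 5.2) gives `L ∈ (G)Λ^{ur}`, so `μ(G) ≤ μ(L) = 0` (BCS 4.2.2); kernel road on frames with
a Heegner datum: `muZero_coprime_of_composite_of_muSharp` below. At `3 ∣ h_K`: BEYOND PRINT — the transfer is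
typed (Thm57Hypotheses) and built (Howard's `ℋ_∞`, `K_k ⊂ K[p^{k+1}]`) under `p ∤ h_K`; the printed defects at
`p ∣ h_K` are powers of `p` (`𝓛_p^Gr = h_K·𝓛_𝔭(K)′·𝓛_p^II`, Yan–Zhu Def. 3.10; the `d(k)`-shift of CGLS §4.1),
i.e. they can only move `μ`. Why it might fail: a `p`-power lost in the transfer at `3 ∣ h_K` that is NOT
recovered — then `μ(G) > 0` would contradict nothing in print; conjecturally `μ(G) = μ(L) = 0` always.
[cite: YanZhu2024MainConjNonCM, Thm. 5.9, Def. 3.10] [cite: BurungaleCastellaKim2021, Thm. 5.2 = arXiv:1908.09512 Thm. 4.1]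
[cite: BurungaleCastellaSkinner2025, Prop. 4.2.2, Thm. 4.2.1 (proof, p. 8)]
[cite: CastellaGrossiLeeSkinner2022, §4.1 (proof of Thm. 4.1.1), Rem. 4.1.4] -/
def Stmt.stub_muZeroOfHowardContainment : Prop :=
  ∀ (W : WeierstrassCurve ℚ) [W.IsElliptic] [W.IsGloballyMinimal] (p : ℕ) [Fact p.Prime]
    [NeZero (W.conductorNorm ℤ)] (K : Type) [Field K] [NumberField K],
    ClassX10 W p → ¬ Surj W 3 → ¬ W.HasCM → IsImaginaryQuadratic K →
    Odd (NumberField.discr K) → NumberField.discr K ≠ -3 →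
    SatisfiesHeegnerHypothesis (W.conductorNorm ℤ) K → SatisfiesHeegnerHypothesis p K →
    (W.baseChange K).HasIrreducibleModPGaloisRep p →
    ∀ (κ : ZpExtension K p), κ.IsAnticyclotomic →
    ∀ (γ : absoluteGaloisGroup K) [Fact (κ.IsTopGenerator γ)]
      (vbar : HeightOneSpectrum (𝓞 K)), ((p : ℕ) : 𝓞 K) ∈ vbar.asIdeal →
    (∃ (jbar : AlgebraicClosure K →+* ℂ) (D : (W.baseChange K).LambdaAdicSelmerData κ γ)
        (F : HeegnerFamily (W.conductorNorm ℤ) W K κ jbar) (X : (W.baseChange K).SelmerDualData κ γ),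
        heegnerCharIdeal D F ^ 2 ≤
          Module.charIdeal (IwasawaAlgebra p) (Submodule.torsion (IwasawaAlgebra p) X.X)) →
    ∀ (G : IwasawaAlgebra p),
      AcSelmer.XAc.charIdeal (W.baseChange K) p κ vbar ∅ γ = Ideal.span {G} →
      PowerSeries.constantCoeff G ≠ 0 → mu G = 0

/-! ## The stubs (the ONLY sorries of the file) -/

theorem stub_muSharpOneSided : Stmt.stub_muSharpOneSided := by
  sorry

theorem stub_muZeroOfHowardContainment : Stmt.stub_muZeroOfHowardContainment := by
  sorry

/-! ## Composition (kernel-checked, no `sorry`) -/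

/-- **B₃ ⇐ stub 1 + stub 2 + the route's by-name item `JSWAnticyclotomicControl`** (JSW 2017 Thm. 3.3.1,
`p ≥ 3`, class-number-free): JSW gives a generator `F` of `Char_Λ(𝒳_ac(κ, v))`, `v = inducedPlace ι`, with
`F(0) ≠ 0`; stub 1 at the conjugate embedding `ι_w` (strict prime `v`) gives `ord F(0) = μ(F) + RHS(ι_w)`;
stub 2 gives `μ(F) = 0`; the σ-bridge gives `RHS(ι_w) = RHS(ι)` in rank one; `p ∤ c(Dt)`. -/
theorem TwoSidedLinkAnyClassNumberX10b_of
    (h1 : Stmt.stub_muSharpOneSided) (h2 : Stmt.stub_muZeroOfHowardContainment)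
    (h331 : Summit.BirchSwinnertonDyer.BirchSwinnertonDyer.Theses.PrintX10b.JSWAnticyclotomicControl) :
    Summit.BirchSwinnertonDyer.BirchSwinnertonDyer.Theses.PrintX10b.TwoSidedLinkAnyClassNumberX10b := by
  unfold Stmt.stub_muSharpOneSided at h1
  unfold Stmt.stub_muZeroOfHowardContainment at h2
  have h331' : thm331_anticyclotomicControl := h331
  intro W _ _ p _ _ K _ _ hX hns hcm hK hodd h3 hHN hHp hirrK ι κ hκ γ _ Dt hc H ιC P hP hrk hfinp
    hPinf hHow
  have hp : 3 ≤ p := hX.three_le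
  obtain ⟨hgood, hord⟩ := id hX.goodOrd
  -- the other prime `w` above `p`, of degree one, and THE embedding at it
  obtain ⟨w, hw, hwne⟩ := X11b.exists_other_prime hHp (X11b.inducedPlace ι)
    (X11b.natCast_mem_inducedPlace ι)
  have hsplit : X11b.SplitsIn K p := hHp p Fact.out (dvd_refl p)
  obtain ⟨he, hf⟩ := X11b.degreeOne_of_splitsIn hK.1 hsplit hw
  set ιw : K →+* ℚ_[p] := X11b.embAt K p w hw he hf with hιw
  -- a generator with non-zero constant term of the module strict at `v = inducedPlace ι`, from JSW
  obtain ⟨-, F, hF, hF0, -⟩ := h331' W p hp hgood K hK hHp hHN hirrK ι (X11b.inducedPlace ι)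
    (X11b.mem_inducedPlace_iff ι) κ hκ γ hrk hfinp P hPinf
  -- stub 1 at the embedding `ιw`, strict prime `inducedPlace ι`: `ord F(0) = μ(F) + RHS(ιw)`
  obtain ⟨n, hn, hval⟩ := h1 W p hp ⟨hgood, hord⟩ K hK hHN hHp hodd h3 hirrK ιw w (X11b.inducedPlace ι)
    (X11b.mem_asIdeal_iff_norm_embAt_lt_one w hw he hf) (X11b.natCast_mem_inducedPlace ι)
    (fun h ↦ hwne h.symm) κ hκ γ (W.conductorNorm ℤ) Dt H ιC P hP F hF hF0
  -- stub 2: `μ(F) = 0`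
  have hmu : mu F = 0 := h2 W p K hX hns hcm hK hodd h3 hHN hHp hirrK κ hκ γ (X11b.inducedPlace ι)
    (X11b.natCast_mem_inducedPlace ι) hHow F hF hF0
  -- `ιw = ι ∘ σ` for an involution `σ`; the log valuations agree in rank one
  obtain ⟨σ, hσ, hισ⟩ := X11b.exists_involutive_comp_eq hK.1 ι ιw
  have hlog : Literature.NumberTheory.EllipticCurves.padicLogOrd W p ιw P = X11b.padicLogOrd W p ι P := by
    rw [← hισ, ← X11b.padicLogOrd_eq_literature]
    exact padicLogOrd_comp_eq_of_rank_one W p (by omega) σ hσ ι hrk P hPinf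
  have hc0 : padicValInt p Dt.c = 0 := padicValInt.eq_zero_of_not_dvd hc
  refine ⟨n, (X11b.AcSelmer.hasCharValuationAt_iff_literature _ p κ (X11b.inducedPlace ι) ∅ γ n).mpr hn,
    ?_⟩
  rw [hlog, hmu, hc0] at hval
  push_cast at hval
  omega

/-! ## Kernel evidence: at `3 ∤ h_K`, stub 2 is print given stub 1 (frames with a Heegner datum) -/

/-- **`μ(𝒳_Gr) = 0` at `p ∤ h_K` from the typed two-sided composite and stub 1**: the composite
`YanZhu2026.…_of_heegnerDivisibility` gives `ord G(0) = RHS`, stub 1 gives `ord G(0) = μ(G) + RHS`, and the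
valuation is well defined (`HasCharValuationAt.unique`). Any odd good ordinary `p`, (irr_K); the Heegner datum
is the composite's (every frame of crux 23730 carries one).
[cite: YanZhu2024MainConjNonCM, Thm. 5.7 (1), Thm. 5.9] [cite: BurungaleCastellaSkinner2025, Prop. 4.2.2]
[cite: CastellaGrossiLeeSkinner2022, Thm. 5.1.3] -/
theorem muZero_coprime_of_composite_of_muSharp
    (hYZ : thm57_thm59_bcs422_cgls513_generator_constantCoeff_of_heegnerDivisibility)
    (h1 : Stmt.stub_muSharpOneSided)
    {W : WeierstrassCurve ℚ} [W.IsElliptic] [W.IsGloballyMinimal] {p : ℕ} [Fact p.Prime]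
    (hp : 3 ≤ p) (hord : GoodOrd W p)
    (K : Type) [Field K] [NumberField K] (hK : IsImaginaryQuadratic K)
    (hHN : SatisfiesHeegnerHypothesis (W.conductorNorm ℤ) K) (hHp : SatisfiesHeegnerHypothesis p K)
    (hodd : Odd (NumberField.discr K)) (h3 : NumberField.discr K ≠ -3)
    (hirrK : (W.baseChange K).HasIrreducibleModPGaloisRep p) (hhK : ¬ p ∣ NumberField.classNumber K)
    (ι : K →+* ℚ_[p]) (v vbar : HeightOneSpectrum (𝓞 K))
    (hv : ∀ x : 𝓞 K, x ∈ v.asIdeal ↔ ‖ι (x : K)‖ < 1)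
    (hvbar : ((p : ℕ) : 𝓞 K) ∈ vbar.asIdeal) (hne : vbar ≠ v)
    (κ : ZpExtension K p) (hκ : κ.IsAnticyclotomic)
    (γ : absoluteGaloisGroup K) [Fact (κ.IsTopGenerator γ)]
    {N : ℕ} [NeZero N] (Dt : ModularParametrizationData W N)
    (H : HeegnerDatum N (NumberField.discr K)) (ιC : K →+* ℂ) (P : (W.baseChange K).toAffine.Point)
    (hP : WeierstrassCurve.Affine.Point.map ιC.toRatAlgHom P = heegnerPointComplex Dt H)
    (hHow : ∃ (jbar : AlgebraicClosure K →+* ℂ) (D : (W.baseChange K).LambdaAdicSelmerData κ γ)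
      (F : HeegnerFamily N W K κ jbar) (X : (W.baseChange K).SelmerDualData κ γ),
      heegnerCharIdeal D F ^ 2 ≤
        Module.charIdeal (IwasawaAlgebra p) (Submodule.torsion (IwasawaAlgebra p) X.X))
    (G : IwasawaAlgebra p) (hG : AcSelmer.XAc.charIdeal (W.baseChange K) p κ vbar ∅ γ = Ideal.span {G})
    (hG0 : PowerSeries.constantCoeff G ≠ 0) :
    mu G = 0 := by
  unfold Stmt.stub_muSharpOneSided at h1
  obtain ⟨n, hn, hval⟩ := hasCharValuationAt_of_heegnerDivisibility hYZ hp hord K hK hHN hHp hodd h3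
    hirrK hhK ι v vbar hv hvbar hne κ hκ γ Dt H ιC P hP hHow G hG hG0
  obtain ⟨n', hn', hval'⟩ := h1 W p hp hord K hK hHN hHp hodd h3 hirrK ι v vbar hv hvbar hne κ hκ γ N Dt
    H ιC P hP G hG hG0
  have hnn : n = n' := hn.unique hn'
  subst hnn
  omega

/-- The composed line from the stubs and the by-name route item (sorries only through `stub_*`). -/
theorem TwoSidedLinkAnyClassNumberX10b_of_stubs
    (h331 : Summit.BirchSwinnertonDyer.BirchSwinnertonDyer.Theses.PrintX10b.JSWAnticyclotomicControl) :
    Summit.BirchSwinnertonDyer.BirchSwinnertonDyer.Theses.PrintX10b.TwoSidedLinkAnyClassNumberX10b :=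
  TwoSidedLinkAnyClassNumberX10b_of stub_muSharpOneSided stub_muZeroOfHowardContainment h331

end Summit.BirchSwinnertonDyer.BirchSwinnertonDyer.Cruxes.TwoSidedLinkAnyClassNumberX10b.GreenbergMuIsolationX10b

end
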